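import Literature.Probability.Percolation.LatticeBoundaryConnectivity
import Literature.Probability.LatticeModels.ThermodynamicLimit
import HarnessLib

/-!
# The inner boundary of a hole-free lattice-connected set is `∗`-connected

Topic `Probability/Percolation`. A companion of the Deuschel–Pisztora / Timár boundary-connectivity
theorem `exists_starWalk_latticeBoundary` (the outer-visible lattice boundary of a finite
lattice-connected subset of `ℤ²` is `∗`-connected): for a finite lattice-connected `A ⊆ ℤ²`
whose complement is lattice-connected, the **inner vertex boundary**
`∂_in A = {h ∈ A : h has a lattice neighbour outside A}` is `∗`-connected
(`exists_starWalk_latticeInnerBdry`; the inner-boundary companion of Timár 2013, Theorem 2).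

Proof: clamp the complement into a box to obtain a finite lattice-connected set `D ⊇ ∂_out A`
disjoint from `A` (`exists_walk_clamp`); for an interior point `v` of `A` the sites of
`∂_out D` visible from `v` are inner-boundary sites of `A`, so the outer theorem applied to `D`
from `v` joins, inside `∂_in A`, the two inner-boundary sites flanking any interior excursion of a
lattice walk in `A`; an induction along a walk in `A` between two inner-boundary sites concludes.

This is used for the pinning lemma of Georgii–Higuchi 2000 (Lemma 5.2): rerouting infinite paths
around a stopping domain through its crust.

## References

* Á. Timár, *Boundary-connectivity via graph theory*, Proc. AMS 141 (2013), Theorem 2 [Timar2013].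
* H.-O. Georgii, Y. Higuchi, J. Math. Phys. 41 (2000), Lemma 5.2 [GeorgiiHiguchi2000].
-/

noncomputable section

open SimpleGraph Finset
open Literature.Probability.LatticeModels (Site zdGraph zdStarGraph zdGraph_adj_iff zdStarGraph_adj
  zdStarGraph_adj_iff zdGraph_le_zdStarGraph box mem_box innerBoundary mem_innerBoundary_iff)

namespace Literature.Probability.Percolation

/-! ### Clamping walks into a box -/

/-- Clamping a site into the box `Λ_N`. [folklore] -/
def clampSite (N : ℕ) (z : Site 2) : Site 2 := fun i => max (-(N : ℤ)) (min (z i) N)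

/-- The clamped site lies in the box. [folklore] -/
theorem clampSite_mem_box (N : ℕ) (z : Site 2) : clampSite N z ∈ box 2 N := by
  rw [mem_box]; intro i; simp only [clampSite]; omega

/-- Clamping fixes the box. [folklore] -/
theorem clampSite_of_mem_box {N : ℕ} {z : Site 2} (hz : z ∈ box 2 N) : clampSite N z = z := by
  rw [mem_box] at hz; funext i; have := hz i; simp only [clampSite]; omega

/-- A site outside `Λ_N` is clamped onto the boundary layer of `Λ_{N+1}`... more precisely, a site
outside `Λ_N` clamped into `Λ_{N+1}` has a coordinate of modulus `N + 1`. [folklore] -/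
theorem exists_abs_clampSite_eq {N : ℕ} {z : Site 2} (hz : z ∉ box 2 N) :
    ∃ i, |clampSite (N + 1) z i| = N + 1 := by
  rw [mem_box] at hz; push Not at hz
  obtain ⟨i, hi⟩ := hz
  refine ⟨i, ?_⟩
  simp only [clampSite]
  push_cast
  by_cases h : -(N : ℤ) ≤ z i
  · have := hi h; rw [abs_of_nonneg (by omega)]; omega
  · rw [abs_of_nonpos (by omega)]; omega

/-- One-dimensional clamping. [folklore] -/
def clamp1 (N t : ℤ) : ℤ := max (-N) (min t N)

/-- Clamping a unit step gives a step of length `0` or `1`. [folklore] -/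
theorem clamp1_succ (N t : ℤ) : clamp1 N (t + 1) = clamp1 N t ∨ clamp1 N (t + 1) = clamp1 N t + 1 := by
  unfold clamp1; omega

/-- Coordinates of the clamped site. [folklore] -/
theorem clampSite_apply (N : ℕ) (z : Site 2) (i : Fin 2) : clampSite N z i = clamp1 N (z i) := rfl

/-- Clamping is a lazy graph map: adjacent sites have equal or adjacent images. [folklore] -/
theorem clampSite_adj_or_eq (N : ℕ) {x y : Site 2} (h : (zdGraph 2).Adj x y) :
    clampSite N x = clampSite N y ∨ (zdGraph 2).Adj (clampSite N x) (clampSite N y) := by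
  have key : ∀ {x y : Site 2}, (y 0 = x 0 + 1 ∧ y 1 = x 1) →
      clampSite N x = clampSite N y ∨ (zdGraph 2).Adj (clampSite N x) (clampSite N y) := by
    intro x y ⟨h0, h1⟩
    have e1 : clampSite N y 1 = clampSite N x 1 := by rw [clampSite_apply, clampSite_apply, h1]
    rcases clamp1_succ N (x 0) with e0 | e0
    · left; funext i; fin_cases i
      · change clampSite N x 0 = clampSite N y 0
        rw [clampSite_apply, clampSite_apply, h0, e0]
      · exact e1.symm
    · right
      rw [zdGraph_two_adj_iff]
      refine Or.inl ⟨?_, e1⟩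
      rw [clampSite_apply, clampSite_apply, h0, e0]
  have key' : ∀ {x y : Site 2}, (y 1 = x 1 + 1 ∧ y 0 = x 0) →
      clampSite N x = clampSite N y ∨ (zdGraph 2).Adj (clampSite N x) (clampSite N y) := by
    intro x y ⟨h1, h0⟩
    have e0 : clampSite N y 0 = clampSite N x 0 := by rw [clampSite_apply, clampSite_apply, h0]
    rcases clamp1_succ N (x 1) with e1 | e1
    · left; funext i; fin_cases i
      · exact e0.symm
      · change clampSite N x 1 = clampSite N y 1
        rw [clampSite_apply, clampSite_apply, h1, e1]
    · right
      rw [zdGraph_two_adj_iff]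
      refine Or.inr (Or.inr (Or.inl ⟨?_, e0⟩))
      rw [clampSite_apply, clampSite_apply, h1, e1]
  rcases (zdGraph_two_adj_iff x y).1 h with hr | hl | hu | hd
  · exact key hr
  · rcases key (x := y) (y := x) ⟨hl.1, hl.2.symm⟩ with he | ha
    · exact Or.inl he.symm
    · exact Or.inr ha.symm
  · exact key' hu
  · rcases key' (x := y) (y := x) ⟨hd.1, hd.2.symm⟩ with he | ha
    · exact Or.inl he.symm
    · exact Or.inr ha.symm

/-- **Clamping a lattice walk**: a lattice walk is mapped by `clampSite N` to a lattice walk between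
the clamped endpoints whose vertices are clamped vertices of the original walk. [folklore] -/
theorem exists_walk_clamp (N : ℕ) : ∀ {a b : Site 2} (p : (zdGraph 2).Walk a b),
    ∃ q : (zdGraph 2).Walk (clampSite N a) (clampSite N b), ∀ z ∈ q.support, ∃ w ∈ p.support, clampSite N w = z
  | _, _, Walk.nil => ⟨Walk.nil, fun z hz => by
      rw [Walk.support_nil, List.mem_singleton] at hz; exact ⟨_, Walk.start_mem_support _, hz.symm⟩⟩
  | a, b, Walk.cons (v := v) hadj p => by
    obtain ⟨q, hq⟩ := exists_walk_clamp N p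
    rcases clampSite_adj_or_eq N hadj with he | hadj'
    · refine ⟨q.copy he.symm rfl, fun z hz => ?_⟩
      rw [Walk.support_copy] at hz
      obtain ⟨w, hw, rfl⟩ := hq z hz
      exact ⟨w, by rw [Walk.support_cons]; exact List.mem_cons_of_mem _ hw, rfl⟩
    · refine ⟨Walk.cons hadj' q, fun z hz => ?_⟩
      rw [Walk.support_cons, List.mem_cons] at hz
      rcases hz with rfl | hz
      · exact ⟨a, Walk.start_mem_support _, rfl⟩
      · obtain ⟨w, hw, rfl⟩ := hq z hz
        exact ⟨w, by rw [Walk.support_cons]; exact List.mem_cons_of_mem _ hw, rfl⟩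

/-! ### The inner boundary -/

/-- Membership in the tree's inner vertex boundary `innerBoundary (zdGraph 2) A` (Timár's `∂_in`). [folklore] -/
theorem mem_innerBoundary_zd {A : Finset (Site 2)} {h : Site 2} :
    h ∈ innerBoundary (zdGraph 2) A ↔ h ∈ A ∧ ∃ y, y ∉ A ∧ (zdGraph 2).Adj h y := by
  rw [mem_innerBoundary_iff]

variable {A : Finset (Site 2)}

/-- A walk from a site of `A` all of whose vertices avoid the sites outside `A` adjacent to `A`
stays inside `A`. [folklore] -/
theorem support_subset_of_avoids_outer {a b : Site 2} (p : (zdGraph 2).Walk a b) (ha : a ∈ A)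
    (hp : ∀ z ∈ p.support, ¬ (z ∉ A ∧ ∃ c ∈ A, (zdGraph 2).Adj z c)) : ∀ z ∈ p.support, z ∈ A := by
  induction p with
  | nil => intro z hz; rw [Walk.support_nil, List.mem_singleton] at hz; exact hz ▸ ha
  | cons hadj p ih =>
    rename_i u v w
    have hv : v ∈ A := by
      by_contra hv
      exact hp v (by simp) ⟨hv, u, ha, hadj.symm⟩
    intro z hz
    rw [Walk.support_cons, List.mem_cons] at hz
    rcases hz with rfl | hz
    · exact ha
    · exact ih hv (fun z hz => hp z (by rw [Walk.support_cons]; exact List.mem_cons_of_mem _ hz)) z hz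

/-- **The inner boundary of a finite lattice-connected set with lattice-connected complement is
`∗`-connected** (the inner-boundary companion of the Deuschel–Pisztora/Timár outer theorem, derived
here from `exists_starWalk_latticeBoundary` applied to the clamped complement seen from an interior
point). [cite: Timar2013, Theorem 2 (outer-visible boundary; applied to the complement)] -/
theorem exists_starWalk_latticeInnerBdry
    (hA : ∀ a ∈ A, ∀ b ∈ A, ∃ q : (zdGraph 2).Walk a b, ∀ z ∈ q.support, z ∈ A)
    (hAc : ∀ a, a ∉ A → ∀ b, b ∉ A → ∃ q : (zdGraph 2).Walk a b, ∀ z ∈ q.support, z ∉ A)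
    {h h' : Site 2} (hh : h ∈ innerBoundary (zdGraph 2) A) (hh' : h' ∈ innerBoundary (zdGraph 2) A) :
    ∃ q : zdStarGraph.Walk h h', ∀ z ∈ q.support, z ∈ innerBoundary (zdGraph 2) A := by
  classical
  -- a box containing `A` with margin
  obtain ⟨N, hN⟩ : ∃ N : ℕ, A ⊆ box 2 N := by
    obtain ⟨M, hM⟩ := (A.image fun z : Site 2 => |z 0| + |z 1|).bddAbove
    refine ⟨M.toNat, fun z hz => ?_⟩
    have := hM (mem_image_of_mem _ hz)
    rw [mem_box]; intro i
    have h0 := abs_nonneg (z 0); have h1 := abs_nonneg (z 1)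
    have : |z i| ≤ M := by fin_cases i <;> simp <;> linarith
    rw [abs_le] at this; omega
  -- the clamped complement `D`
  set D : Finset (Site 2) := (box 2 (N + 1)).filter (fun z => z ∉ A) with hD
  have hmemD : ∀ z, z ∈ D ↔ z ∈ box 2 (N + 1) ∧ z ∉ A := fun z => by rw [hD, mem_filter]
  have hboxmono : ∀ z, z ∈ box 2 N → z ∈ box 2 (N + 1) := fun z hz => by
    rw [mem_box] at hz ⊢; intro i; have := hz i; push_cast; omega
  -- sites outside `A` adjacent to `A` are in `D`
  have houtD : ∀ y, y ∉ A → (∃ c ∈ A, (zdGraph 2).Adj y c) → y ∈ D := by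
    rintro y hy ⟨c, hc, hyc⟩
    refine (hmemD y).2 ⟨?_, hy⟩
    have hcb := mem_box.1 (hN hc)
    rw [mem_box]; intro i
    have h0 := hcb 0; have h1 := hcb 1
    rcases (zdGraph_two_adj_iff y c).1 hyc with ⟨e0, e1⟩ | ⟨e0, e1⟩ | ⟨e1, e0⟩ | ⟨e1, e0⟩ <;>
      fin_cases i <;> simp <;> omega
  -- `D` is lattice-connected (clamp the complement walks into the box `Λ_{N+1}`)
  have hDconn : ∀ a ∈ D, ∀ b ∈ D, ∃ q : (zdGraph 2).Walk a b, ∀ z ∈ q.support, z ∈ D := by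
    intro a ha b hb
    obtain ⟨ha1, ha2⟩ := (hmemD a).1 ha
    obtain ⟨hb1, hb2⟩ := (hmemD b).1 hb
    obtain ⟨q, hq⟩ := hAc a ha2 b hb2
    obtain ⟨q', hq'⟩ := exists_walk_clamp (N + 1) q
    refine ⟨(q'.copy (clampSite_of_mem_box ha1) (clampSite_of_mem_box hb1)), fun z hz => ?_⟩
    rw [Walk.support_copy] at hz
    obtain ⟨w, hw, rfl⟩ := hq' z hz
    refine (hmemD _).2 ⟨clampSite_mem_box _ _, fun hwA => ?_⟩
    by_cases hwb : w ∈ box 2 (N + 1)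
    · rw [clampSite_of_mem_box hwb] at hwA; exact hq w hw hwA
    · -- `w` outside the box: its clamp has a coordinate `±(N+1)`, not in `A ⊆ Λ_N`
      have hwb' : w ∉ box 2 N := fun h => hwb (hboxmono w h)
      obtain ⟨i, hi⟩ := exists_abs_clampSite_eq (N := N) hwb'
      have := mem_box.1 (hN hwA) i
      rcases abs_eq (show (0 : ℤ) ≤ N + 1 by positivity) |>.1 hi with h | h <;> omega
  -- interior points are not adjacent to `D`
  have hint : ∀ v ∈ A, v ∉ innerBoundary (zdGraph 2) A → ∀ c ∈ D, ¬ (zdGraph 2).Adj v c := by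
    intro v hv hvb c hc hvc
    exact hvb (mem_innerBoundary_zd.2 ⟨hv, c, ((hmemD c).1 hc).2, hvc⟩)
  -- walks from `A` avoiding `D` stay in `A`
  have hstay : ∀ {a b : Site 2} (p : (zdGraph 2).Walk a b), a ∈ A → (∀ z ∈ p.support, z ∉ D) →
      ∀ z ∈ p.support, z ∈ A := fun p ha hp =>
    support_subset_of_avoids_outer p ha fun z hz ⟨hzA, hzadj⟩ => hp z hz (houtD z hzA hzadj)
  -- visible boundary sites of `D` from an interior point are inner-boundary sites of `A`
  have hvis : ∀ v ∈ A, ∀ y ∈ LOutVis D v, y ∈ innerBoundary (zdGraph 2) A := by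
    intro v hv y hy
    obtain ⟨⟨hyD, ⟨c, hc, hyc⟩, w, hw⟩, -⟩ := hy
    have hyA : y ∈ A := hstay w hv hw y (Walk.end_mem_support w)
    exact mem_innerBoundary_zd.2 ⟨hyA, c, ((hmemD c).1 hc).2, hyc⟩
  -- induction along a walk in `A` from `h` to `h'`
  obtain ⟨p, hp⟩ := hA h (mem_innerBoundary_zd.1 hh).1 h' (mem_innerBoundary_zd.1 hh').1
  suffices H : ∀ (n : ℕ) {u : Site 2} (p : (zdGraph 2).Walk u h'), p.length ≤ n → u ∈ innerBoundary (zdGraph 2) A →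
      (∀ z ∈ p.support, z ∈ A) → ∃ q : zdStarGraph.Walk u h', ∀ z ∈ q.support, z ∈ innerBoundary (zdGraph 2) A from
    H p.length p le_rfl hh hp
  intro n
  induction n with
  | zero =>
    intro u p hpl hu _
    have : p.length = 0 := by omega
    obtain rfl := Walk.eq_of_length_eq_zero this
    exact ⟨Walk.nil, fun z hz => by rw [Walk.support_nil, List.mem_singleton] at hz; exact hz ▸ hu⟩
  | succ n ih =>
    intro u p hpl hu hpA
    cases p with
    | nil => exact ⟨Walk.nil, fun z hz => by rw [Walk.support_nil, List.mem_singleton] at hz; exact hz ▸ hu⟩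
    | cons hadj p' =>
      rename_i v
      have hpA' : ∀ z ∈ p'.support, z ∈ A := fun z hz => hpA z (by rw [Walk.support_cons]; exact List.mem_cons_of_mem _ hz)
      have hv : v ∈ A := hpA' v (Walk.start_mem_support p')
      have hlen : p'.length ≤ n := by rw [Walk.length_cons] at hpl; omega
      by_cases hvb : v ∈ innerBoundary (zdGraph 2) A
      · obtain ⟨q, hq⟩ := ih p' hlen hvb hpA'
        refine ⟨Walk.cons (zdGraph_le_zdStarGraph hadj) q, fun z hz => ?_⟩
        rw [Walk.support_cons, List.mem_cons] at hz
        rcases hz with rfl | hz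
        · exact hu
        · exact hq z hz
      · -- interior excursion: first inner-boundary vertex `g` of `p'` after `v`
        obtain ⟨a, g, W₀, hag, hg, hgp', hW₀b, hW₀p'⟩ := exists_split_first_mem' (S := (↑(innerBoundary (zdGraph 2) A) : Set (Site 2))) p' hvb
          ⟨h', Walk.end_mem_support p', hh'⟩
        -- `u ∗~ g` inside `∂_in A` (outer theorem for `D` seen from `v`)
        have hvD : v ∉ D := fun hvD' => ((hmemD v).1 hvD').2 hv
        have hAD : ∀ z ∈ A, z ∉ D := fun z hz hzD => ((hmemD z).1 hzD).2 hz
        have hLV : ∀ y ∈ innerBoundary (zdGraph 2) A, (∃ w : (zdGraph 2).Walk v y, ∀ z ∈ w.support, z ∉ D) → y ∈ LVis D v := by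
          rintro y hy ⟨w, hw⟩
          obtain ⟨hyA, c, hcA, hyc⟩ := mem_innerBoundary_zd.1 hy
          exact ⟨fun hyD => ((hmemD y).1 hyD).2 hyA, ⟨c, houtD c hcA ⟨y, hyA, hyc.symm⟩, hyc⟩, w, hw⟩
        have hw1 : ∀ z ∈ (Walk.cons hadj.symm (Walk.nil : (zdGraph 2).Walk u u)).support, z = v ∨ z = u :=
          fun z hz => by simpa using hz
        have huOut : u ∈ LOutVis D v := by
          refine ⟨hLV u hu ⟨Walk.cons hadj.symm Walk.nil, fun z hz => ?_⟩, Walk.cons hadj.symm Walk.nil,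
            fun z hz => ?_, fun z hz hzu => ?_⟩
          · rcases hw1 z hz with h1 | h1 <;> rw [h1]
            · exact hvD
            · exact hAD u (mem_innerBoundary_zd.1 hu).1
          · rcases hw1 z hz with h1 | h1 <;> rw [h1]
            · exact hvD
            · exact hAD u (mem_innerBoundary_zd.1 hu).1
          · rcases hw1 z hz with h1 | h1
            · rw [h1]; rintro ⟨-, ⟨c, hc, hzc⟩, -⟩; exact hint v hv hvb c hc hzc
            · exact absurd h1 hzu
        let W₁ : (zdGraph 2).Walk v g := W₀.append (Walk.cons hag Walk.nil)
        have hW₁supp : ∀ z, z ∈ W₁.support ↔ z ∈ W₀.support ∨ z = g := fun z => by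
          simp only [W₁, Walk.mem_support_append_iff, Walk.support_cons, Walk.support_nil, List.mem_cons,
            List.not_mem_nil, or_false]
          constructor
          · rintro (h1 | h1 | h1)
            · exact Or.inl h1
            · exact Or.inl (h1 ▸ Walk.end_mem_support W₀)
            · exact Or.inr h1
          · rintro (h1 | h1)
            · exact Or.inl h1
            · exact Or.inr (Or.inr h1)
        have hW₀A : ∀ z ∈ W₀.support, z ∈ A := fun z hz => hpA' z (hW₀p' z hz)
        have hgA : g ∈ A := (mem_innerBoundary_zd.1 hg).1
        have hgOut : g ∈ LOutVis D v := by
          refine ⟨hLV g hg ⟨W₁, fun z hz => ?_⟩, W₁, fun z hz => ?_, fun z hz hzg => ?_⟩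
          · rcases (hW₁supp z).1 hz with hz | hz
            · exact hAD z (hW₀A z hz)
            · rw [hz]; exact hAD g hgA
          · rcases (hW₁supp z).1 hz with hz | hz
            · exact hAD z (hW₀A z hz)
            · rw [hz]; exact hAD g hgA
          · rcases (hW₁supp z).1 hz with hz' | hz'
            · rintro ⟨-, ⟨c, hc, hzc⟩, -⟩
              exact hint z (hW₀A z hz') (hW₀b z hz') c hc hzc
            · exact absurd hz' hzg
        obtain ⟨q₁, hq₁⟩ := exists_starWalk_latticeBoundary (C := D) (x₀ := v) hDconn hvD
          (fun c hc => hint v hv hvb c hc) huOut hgOut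
        -- `g ∗~ h'` by induction on the tail of `p'` from `g`
        have hgp : (p'.dropUntil g hgp').length ≤ n :=
          (Walk.length_dropUntil_le_length p' hgp').trans hlen
        obtain ⟨q₂, hq₂⟩ := ih (p'.dropUntil g hgp') hgp hg
          (fun z hz => hpA' z (Walk.support_dropUntil_subset_support p' hgp' hz))
        exact ⟨q₁.append q₂, fun z hz => by
          rw [Walk.mem_support_append_iff] at hz
          rcases hz with hz | hz
          · exact hvis v hv z (hq₁ z hz)
          · exact hq₂ z hz⟩

end Literature.Probability.Percolation
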